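import Mathlib
import HarnessLib
import Summits.PneNP.PneNP.Theses.CnfIdealGenLength
import Summits.PneNP.PneNP.Theorems.CnfIdealGenLengthRankStability
import Summits.PneNP.PneNP.Theorems.CnfIdealGenLengthRankDefectRepresentationsExactification
import Summits.PneNP.PneNP.Theorems.CnfIdealGenLengthRankDefectRepresentationsSortingLemma
import Summits.PneNP.PneNP.Theorems.CnfIdealGenLengthRankDefectRepresentationsTseitinTransferRank
import Literature.Computability.AlgebraicComplexity.MignonRessayreBound

/-!
# Crux `RankDefectRepresentations` (stmt-PneNP-18923), line `rank-dehn-ladder`: UNIFORM rank-stability refutes the crux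

Negative composition of the skeleton `Cruxes/RankDefectRepresentations/Lines/rank_dehn_ladder.lean` (lead g5), kernel-checked:

* `polyStable_of_uniformStability`: IF the elementary abelian group `Z_2^n = (2^{[n]}, △)` is UNIFORMLY rank-stable with a
  constant polynomial in `n` — every map `ρ` with `ρ ∅ = 1` whose whole multiplication table holds up to rank `δ`
  (`rank (ρ(S)ρ(T) − ρ(S△T)) ≤ δ` for all `S, T`) is within rank `n^a · δ` of a genuine representation `π` — THEN the
  Boolean/commutator presentation of `n` commuting idempotents is POLYNOMIALLY rank-stable (the hypothesis `hST` of
  `not_rankDefectRepresentations_of_polyStable`, p542939, with exponent `a + 3`). Route: exactify the almost-idempotents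
  (`exists_idempotent_near`, cost `≤ t`, commutators `≤ 5t`), pass to involutions `U_i = 1 − 2E_i`, read their SORTED
  PRODUCTS as a uniform `5n²t`-almost-homomorphism (the sorting lemma `stub_sortingLemma`), replace it by a genuine `π`,
  and return to the commuting idempotents `M'_i = (1 − π{i})/2`.
* `not_rankDefectRepresentations_of_uniformStability`: hence uniform rank-stability of `Z_2^n` with a polynomial constant
  REFUTES the crux.

Context (why this is the right currency): for the multiplication-table presentation of EVERY finite group the stability
constant is ABSOLUTE in the Hilbert–Schmidt metric (Gowers–Hatami 2017) and in permutations (Becker–Chapman, JEMS 2023);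
in the rank metric the only known proof (Bauer–Blachar–Greenfeld, IMRN 2025, Thm 5.1; Glebsky–Rivera good subspace) pays the
group ORDER `2^n`, because rank admits no averaging. Whether `Z_2^n` is uniformly rank-stable with constant `poly(n)` (=
polylog of the group order) is open; this file records that a positive answer settles the item negatively.
HONEST FRAMING: a conditional reduction; the crux, GL_noncomm and P ≠ NP are not moved; F-N2 is a FRONTIER formal rung.
-/

set_option linter.dupNamespace false -- `Summit.PneNP.PneNP.…`: summit = sub-problem name (D-0017)

namespace Summit.PneNP.PneNP.Theorems.CnfIdealGenLengthRankDefectRepresentationsUniformStability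

open Filter
open Literature.Computability.Complexity
open Literature.Computability.MetaComplexity
open Literature.Computability.MetaComplexity.NCIPS
open Summit.PneNP.PneNP.Theorems.CnfIdealGenLength
open Summit.PneNP.PneNP.Theorems.CnfIdealGenLengthRankDefectRepresentationsSortingLemma (stub_sortingLemma)
open Literature.Computability.AlgebraicComplexity (rank_add_le rank_smul_le)
open Summit.PneNP.PneNP.Theorems.CnfIdealGenLengthRankDefectRepresentationsTseitinTransfer (rk_sub)

section Tools

variable {K : Type} [Field K] {n d : ℕ}

/-- The sorted product over the empty set is `1`. -/
theorem sortedProd_empty (U : Fin n → Matrix (Fin d) (Fin d) K) : (((List.finRange n).filter (· ∈ (∅ : Finset (Fin n)))).map U).prod = 1 := by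
  simp

/-- Filtering a duplicate-free list containing `i` by membership in `{i}` and multiplying gives `U i`. -/
theorem prod_map_filter_singleton (U : Fin n → Matrix (Fin d) (Fin d) K) (i : Fin n) :
    ∀ l : List (Fin n), l.Nodup → i ∈ l →
      ((l.filter (· ∈ ({i} : Finset (Fin n)))).map U).prod = U i
  | [], _, h => by simp at h
  | a :: l, hnd, hmem => by
      classical
      rw [List.nodup_cons] at hnd
      by_cases hai : a = i
      · subst hai
        have hnil : l.filter (· ∈ ({a} : Finset (Fin n))) = [] := by
          rw [List.filter_eq_nil_iff]
          intro x hx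
          have hxa : x ≠ a := fun h => hnd.1 (h ▸ hx)
          simpa using hxa
        rw [List.filter_cons_of_pos (by simp), List.map_cons, List.prod_cons, hnil]
        simp
      · have him : i ∈ l := by
          rcases List.mem_cons.mp hmem with h | h
          · exact absurd h.symm hai
          · exact h
        rw [List.filter_cons_of_neg (by simpa using hai)]
        exact prod_map_filter_singleton U i l hnd.2 him

/-- The sorted product over a singleton is the letter itself. -/
theorem sortedProd_singleton (U : Fin n → Matrix (Fin d) (Fin d) K) (i : Fin n) : (((List.finRange n).filter (· ∈ ({i} : Finset (Fin n)))).map U).prod = U i :=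
  prod_map_filter_singleton U i (List.finRange n) (List.nodup_finRange n) (List.mem_finRange i)

end Tools

/-- **Uniform stability + sorting ⟹ polynomial stability of the Boolean/commutator presentation** (the hypothesis
`hST` of `not_rankDefectRepresentations_of_polyStable`, with exponent `a + 3`). [folklore] -/
theorem polyStable_of_uniformStability
    (hU : ∃ a : ℕ, ∀ᶠ n : ℕ in atTop, ∀ (K : Type) [Field K] [CharZero K] (d δ : ℕ)
      (ρ : Finset (Fin n) → Matrix (Fin d) (Fin d) K), ρ ∅ = 1 →
      (∀ S T : Finset (Fin n), (ρ S * ρ T - ρ (symmDiff S T)).rank ≤ δ) →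
      ∃ π : Finset (Fin n) → Matrix (Fin d) (Fin d) K, π ∅ = 1 ∧
        (∀ S T : Finset (Fin n), π S * π T = π (symmDiff S T)) ∧
        ∀ S : Finset (Fin n), (ρ S - π S).rank ≤ n ^ a * δ) :
    ∃ a : ℕ, ∀ᶠ n : ℕ in atTop, ∀ (K : Type) [Field K] [CharZero K] (d t : ℕ)
      (M : Fin n → Matrix (Fin d) (Fin d) K),
      (∀ g : MonoidAlgebra K (FreeMonoid (Fin n)), IsAxiom g →
        (MonoidAlgebra.lift K (Matrix (Fin d) (Fin d) K) (FreeMonoid (Fin n)) (FreeMonoid.lift M) g).rank ≤ t) →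
      ∃ M' : Fin n → Matrix (Fin d) (Fin d) K, (∀ i, M' i * M' i = M' i) ∧ (∀ i j, M' i * M' j = M' j * M' i) ∧
        ∀ i, (M i - M' i).rank ≤ n ^ a * t := by
  obtain ⟨a, ha⟩ := hU
  refine ⟨a + 3, ?_⟩
  filter_upwards [ha, eventually_ge_atTop 6] with n hn hn6 K _ _ d t M hM
  classical
  -- Step 1: exact idempotents within rank `t`
  have hsq : ∀ i, (M i * M i - M i).rank ≤ t := fun i => by
    have := hM (X K i * X K i - X K i) (Or.inl ⟨i, rfl⟩)
    simpa [X] using this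
  have hcm : ∀ i j, (M i * M j - M j * M i).rank ≤ t := fun i j => by
    by_cases hij : i = j
    · subst hij; simp
    · have := hM (X K i * X K j - X K j * X K i) (Or.inr ⟨i, j, hij, rfl⟩)
      simpa [X] using this
  choose E hE hEM using fun i => exists_idempotent_near (M i)
  have hs : ∀ i, (M i - E i).rank ≤ t := fun i => (hEM i).trans (hsq i)
  have hs' : ∀ i, (E i - M i).rank ≤ t := fun i => by
    rw [← rank_neg_eq]; simpa using hs i
  have hcE : ∀ i j, (E i * E j - E j * E i).rank ≤ 5 * t := by
    intro i j
    have h1 : E i * E j - E j * E i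
        = (M i * M j - M j * M i) + ((E i - M i) * E j + M i * (E j - M j))
          - ((E j - M j) * E i + M j * (E i - M i)) := by noncomm_ring
    rw [h1]
    have r0 := rk_sub ((M i * M j - M j * M i) + ((E i - M i) * E j + M i * (E j - M j)))
      ((E j - M j) * E i + M j * (E i - M i))
    have r1 := rank_add_le (M i * M j - M j * M i) ((E i - M i) * E j + M i * (E j - M j))
    have r2 := rank_add_le ((E i - M i) * E j) (M i * (E j - M j))
    have r3 := rank_add_le ((E j - M j) * E i) (M j * (E i - M i))
    have e1 := (Matrix.rank_mul_le_left (E i - M i) (E j)).trans (hs' i)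
    have e2 := (Matrix.rank_mul_le_right (M i) (E j - M j)).trans (hs' j)
    have e3 := (Matrix.rank_mul_le_left (E j - M j) (E i)).trans (hs' j)
    have e4 := (Matrix.rank_mul_le_right (M j) (E i - M i)).trans (hs' i)
    have e0 := hcm i j
    omega
  -- Step 2: involutions
  let U : Fin n → Matrix (Fin d) (Fin d) K := fun i => 1 - (2 : K) • E i
  have hU : ∀ i, U i * U i = 1 := by
    intro i
    show (1 - (2 : K) • E i) * (1 - (2 : K) • E i) = 1
    have h4 : ((2 : K) • E i) * ((2 : K) • E i) = (4 : K) • E i := by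
      rw [smul_mul_smul_comm, hE i]; norm_num
    simp only [sub_mul, mul_sub, one_mul, mul_one, h4]
    module
  have hUc : ∀ i j, (U i * U j - U j * U i).rank ≤ 5 * t := by
    intro i j
    have h1 : U i * U j - U j * U i = (4 : K) • (E i * E j - E j * E i) := by
      show (1 - (2 : K) • E i) * (1 - (2 : K) • E j) - (1 - (2 : K) • E j) * (1 - (2 : K) • E i) = _
      simp only [sub_mul, mul_sub, smul_mul_smul_comm, one_mul, mul_one, smul_sub]
      module
    rw [h1]
    refine le_trans ?_ (hcE i j)
    exact rank_smul_le _ _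
  -- Step 3: the sorted products are a uniform almost-homomorphism
  have hρ0 : (((List.finRange n).filter (· ∈ (∅ : Finset (Fin n)))).map U).prod = 1 := sortedProd_empty U
  have hρ : ∀ S T : Finset (Fin n),
      ((((List.finRange n).filter (· ∈ S)).map U).prod * (((List.finRange n).filter (· ∈ T)).map U).prod - (((List.finRange n).filter (· ∈ (symmDiff S T))).map U).prod).rank ≤ n * n * (5 * t) := by
    intro S T
    refine (stub_sortingLemma K n d (5 * t) U hU hUc S T).trans ?_
    have h1 : S.card ≤ n := by simpa using S.card_le_univ
    have h2 : T.card ≤ n := by simpa using T.card_le_univ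
    exact Nat.mul_le_mul_right _ (Nat.mul_le_mul h1 h2)
  -- Step 4: uniform stability
  obtain ⟨π, hπ0, hπ, hdist⟩ := hn K d (n * n * (5 * t)) (fun S : Finset (Fin n) => (((List.finRange n).filter (· ∈ S)).map U).prod) hρ0 hρ
  -- Step 5: back to idempotents
  have h2 : (2 : K) ≠ 0 := two_ne_zero
  have hπsq : ∀ i : Fin n, π {i} * π {i} = 1 := fun i => by
    rw [hπ, symmDiff_self]; simpa using hπ0
  refine ⟨fun i => (2 : K)⁻¹ • (1 - π {i}), fun i => ?_, fun i j => ?_, fun i => ?_⟩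
  · -- idempotent
    have key : (1 - π {i}) * (1 - π {i}) = (2 : K) • (1 - π {i}) := by
      simp only [sub_mul, mul_sub, one_mul, mul_one, hπsq i]
      module
    rw [smul_mul_smul_comm, key, smul_smul]
    congr 1
    rw [mul_assoc, inv_mul_cancel₀ h2, mul_one]
  · -- commuting
    rw [smul_mul_smul_comm, smul_mul_smul_comm]
    congr 1
    simp only [sub_mul, mul_sub, one_mul, mul_one, hπ, symmDiff_comm {j} {i}]
    abel
  · -- rank (M i - M' i) ≤ t + 5 n^{a+2} t ≤ n^{a+3} t
    have hEi : E i = (2 : K)⁻¹ • (1 - U i) := by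
      show E i = (2 : K)⁻¹ • (1 - (1 - (2 : K) • E i))
      rw [sub_sub_cancel, smul_smul, inv_mul_cancel₀ h2, one_smul]
    have hUi : U i = (((List.finRange n).filter (· ∈ ({i} : Finset (Fin n)))).map U).prod := (sortedProd_singleton U i).symm
    have hdiff : M i - (2 : K)⁻¹ • (1 - π {i}) = (M i - E i) + (2 : K)⁻¹ • (π {i} - (((List.finRange n).filter (· ∈ ({i} : Finset (Fin n)))).map U).prod) := by
      rw [hEi, ← hUi]; module
    rw [hdiff]
    refine (rank_add_le _ _).trans ?_
    have hr : ((2 : K)⁻¹ • (π {i} - (((List.finRange n).filter (· ∈ ({i} : Finset (Fin n)))).map U).prod)).rank ≤ n ^ a * (n * n * (5 * t)) := by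
      refine le_trans (rank_smul_le _ _) ?_
      rw [← rank_neg_eq, neg_sub]
      exact hdist {i}
    refine (Nat.add_le_add (hs i) hr).trans ?_
    have hle : t + n ^ a * (n * n * (5 * t)) = (1 + 5 * n ^ (a + 2)) * t := by ring
    rw [hle]
    refine Nat.mul_le_mul_right t ?_
    have hn1 : 1 ≤ n ^ (a + 2) := Nat.one_le_pow _ _ (by omega)
    calc 1 + 5 * n ^ (a + 2) ≤ 6 * n ^ (a + 2) := by omega
      _ ≤ n * n ^ (a + 2) := Nat.mul_le_mul_right _ hn6
      _ = n ^ (a + 3) := by ring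


/-- **Uniform rank-stability of `Z_2^n` with a polynomial constant REFUTES the crux `RankDefectRepresentations`.** -/
theorem not_rankDefectRepresentations_of_uniformStability
    (hU : ∃ a : ℕ, ∀ᶠ n : ℕ in atTop, ∀ (K : Type) [Field K] [CharZero K] (d δ : ℕ)
      (ρ : Finset (Fin n) → Matrix (Fin d) (Fin d) K), ρ ∅ = 1 →
      (∀ S T : Finset (Fin n), (ρ S * ρ T - ρ (symmDiff S T)).rank ≤ δ) →
      ∃ π : Finset (Fin n) → Matrix (Fin d) (Fin d) K, π ∅ = 1 ∧
        (∀ S T : Finset (Fin n), π S * π T = π (symmDiff S T)) ∧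
        ∀ S : Finset (Fin n), (ρ S - π S).rank ≤ n ^ a * δ) :
    ¬ Summit.PneNP.PneNP.Theses.CnfIdealGenLength.RankDefectRepresentations :=
  not_rankDefectRepresentations_of_polyStable (polyStable_of_uniformStability hU)

end Summit.PneNP.PneNP.Theorems.CnfIdealGenLengthRankDefectRepresentationsUniformStability
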